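import Mathlib
import Summits.Ventures.DiscreteObjects.Mahler.SmallMeasureCensus
import Summits.Ventures.DiscreteObjects.Mahler.SchwarzPickCoeff
import Summits.Ventures.DiscreteObjects.Mahler.BlaschkeData
import Summits.Ventures.DiscreteObjects.Mahler.GraeffeIdentity

/-!
# Nonreciprocal integer polynomials have Mahler measure `≥ (1 + √17)/4` (venture `DiscreteObjects`, target L)

Cell `pub-namedobj`, seat `pub-namedobj-mahler` (gen 7). Framing: lottery ticket; floor = certified
bounds/negative ranges.

We PROVE the classical first step of Smyth's 1971 argument ([McKee–Smyth, *Around the Unit Circle*,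
§12.2.1, (12.6)–(12.10) p.209]): if `P ∈ ℤ[X]` has `P(0) ≠ 0` and is not (anti)reciprocal
(`P.reverse ≠ ± P`), then `M(P) ≥ (1 + √17)/4 = 1.2807…` (`intMahlerMeasure_ge_of_nonreciprocal`).
In particular `M(P) > 1.28 > M(L) = 1.17628…` (Lehmer's polynomial), so NO nonreciprocal integer
polynomial is sub-Lehmer — unconditionally, without Smyth's full theorem `M(P) ≥ θ₀ = 1.3247…` (the
named fact `Literature.NumberTheory.MahlerMeasure.NonreciprocalMahlerBound`, typed but not proved in
the tree).  This removes the Smyth hypothesis from the census kernel (`NonreciprocalStructure.lean`).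

Proof (Hardy-function method).  Reduce to `P` monic with `P(0) = ε = ±1` (else `M ≥ 2`).  With the
Blaschke data `f, g` of `BlaschkeData.lean` (`f · P* = ε P · g` on the disc, `‖f‖, ‖g‖ ≤ 1`,
`‖g 0‖ = 1/M`, `f 0 = g 0 = c`) and the integer identity `ε P = P* (1 + a X^k) + X^{k+1} R` (`k ≥ 1`,
`a ≠ 0`), average over the `k`-th roots of unity: the averages `Φ_f, Φ_g` are rotation invariant, hence
`Φ_f = c + z^k ψ_f`, `Φ_g = c + z^k ψ_g` (`SchwarzPickCoeff.exists_flat_of_rotation_invariant`), with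
`ψ_f(0) = ψ_g(0) + a c` (comparison near `0`, where `P* ≠ 0`).  The Schwarz–Pick coefficient bound
gives `‖ψ_f(0)‖, ‖ψ_g(0)‖ ≤ 1 - ‖c‖²`; hence `|a|/M ≤ 2(1 - 1/M²)`, i.e. `2M² - M - 2 ≥ 0`.
-/

namespace Summit.Ventures.DiscreteObjects.Mahler

open Polynomial Complex Metric Set Filter Topology
open scoped ComplexConjugate

/-! ### Averaging over the `k`-th roots of unity -/

/-- Rotations by a unimodular `ω` preserve discs around `0`. -/
theorem pow_mul_mem_ball {ω : ℂ} (hω : ‖ω‖ = 1) (j : ℕ) {r : ℝ} {z : ℂ} (hz : z ∈ ball (0 : ℂ) r) :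
    ω ^ j * z ∈ ball (0 : ℂ) r := by
  rw [mem_ball_zero_iff] at hz ⊢
  rw [norm_mul, norm_pow, hω, one_pow, one_mul]; exact hz

/-- The rotation average `z ↦ k⁻¹ Σ_{j<k} h(ω^j z)` of a function holomorphic on a disc around `0` is
holomorphic there. -/
theorem differentiableOn_rotAvg (k : ℕ) {ω : ℂ} (hω : ‖ω‖ = 1) {h : ℂ → ℂ} {r : ℝ}
    (hd : DifferentiableOn ℂ h (ball 0 r)) :
    DifferentiableOn ℂ (fun z => (k : ℂ)⁻¹ * ∑ j ∈ Finset.range k, h (ω ^ j * z)) (ball 0 r) := by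
  apply DifferentiableOn.const_mul
  apply DifferentiableOn.fun_sum
  intro j _
  exact hd.comp ((differentiableOn_const _).mul differentiableOn_id) fun z hz => pow_mul_mem_ball hω j hz

/-- The rotation average of a function bounded by `1` on the unit disc is bounded by `1`. -/
theorem norm_rotAvg_le_one {k : ℕ} (hk : 1 ≤ k) {ω : ℂ} (hω : ‖ω‖ = 1) {h : ℂ → ℂ}
    (hb : ∀ z ∈ ball (0 : ℂ) 1, ‖h z‖ ≤ 1) {z : ℂ} (hz : z ∈ ball (0 : ℂ) 1) :
    ‖(k : ℂ)⁻¹ * ∑ j ∈ Finset.range k, h (ω ^ j * z)‖ ≤ 1 := by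
  have hk0 : (k : ℝ) ≠ 0 := by exact_mod_cast (by omega : k ≠ 0)
  rw [norm_mul, norm_inv, Complex.norm_natCast]
  have hsum : ‖∑ j ∈ Finset.range k, h (ω ^ j * z)‖ ≤ k := by
    calc ‖∑ j ∈ Finset.range k, h (ω ^ j * z)‖ ≤ ∑ j ∈ Finset.range k, ‖h (ω ^ j * z)‖ :=
          norm_sum_le _ _
      _ ≤ ∑ j ∈ Finset.range k, (1 : ℝ) :=
          Finset.sum_le_sum fun j _ => hb _ (pow_mul_mem_ball hω j hz)
      _ = k := by simp
  calc (k : ℝ)⁻¹ * ‖∑ j ∈ Finset.range k, h (ω ^ j * z)‖ ≤ (k : ℝ)⁻¹ * k := by gcongr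
    _ = 1 := inv_mul_cancel₀ hk0

/-- The rotation average is rotation invariant (`ω^k = 1`). -/
theorem rotAvg_rot (k : ℕ) {ω : ℂ} (hωk : ω ^ k = 1) (h : ℂ → ℂ) (z : ℂ) :
    (k : ℂ)⁻¹ * ∑ j ∈ Finset.range k, h (ω ^ j * (ω * z)) =
      (k : ℂ)⁻¹ * ∑ j ∈ Finset.range k, h (ω ^ j * z) := by
  congr 1
  set F : ℕ → ℂ := fun j => h (ω ^ j * z) with hF
  have h1 : ∀ j, h (ω ^ j * (ω * z)) = F (j + 1) := by
    intro j; simp only [hF, pow_succ]; ring_nf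
  simp_rw [h1]
  have h2 := Finset.sum_range_succ' F k
  have h3 := Finset.sum_range_succ F k
  have h4 : F k = F 0 := by simp [hF, hωk]
  rw [h4] at h3
  have : ∑ j ∈ Finset.range k, F (j + 1) = ∑ j ∈ Finset.range k, F j := by
    have := h2.symm.trans h3
    exact add_right_cancel this
  simpa [hF] using this

/-- The rotation average at `0`. -/
theorem rotAvg_zero {k : ℕ} (hk : 1 ≤ k) (ω : ℂ) (h : ℂ → ℂ) :
    (k : ℂ)⁻¹ * ∑ j ∈ Finset.range k, h (ω ^ j * 0) = h 0 := by
  have hk0 : (k : ℂ) ≠ 0 := by exact_mod_cast (by omega : k ≠ 0)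
  simp [Finset.sum_const, Finset.card_range, inv_mul_cancel_left₀ hk0]

/-! ### The key inequality -/

/-- **Key inequality.**  If `P` is monic with `P(0) = ε = ±1` and `ε P = P* (1 + a X^k) + X^{k+1} R`
with `k ≥ 1`, then `|a| / M(P) ≤ 2 (1 - 1/M(P)²)`. -/
theorem abs_mul_inv_measure_le {P : ℤ[X]} (hmonic : P.Monic) {ε : ℤ} (hε : P.coeff 0 = ε)
    (hε1 : ε * ε = 1) {k : ℕ} {a : ℤ} {R : ℤ[X]} (hk : 1 ≤ k)
    (hid : C ε * P = P.reverse * (1 + C a * X ^ k) + X ^ (k + 1) * R) :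
    |(a : ℝ)| * (intMahlerMeasure P)⁻¹ ≤ 2 * (1 - (intMahlerMeasure P)⁻¹ ^ 2) := by
  obtain ⟨f, g, hfd, hgd, hfb, hgb, hfg, hg0, hf0⟩ := exists_blaschke_data hmonic hε hε1
  have hball : ball (0 : ℂ) 1 ∈ 𝓝 (0 : ℂ) := ball_mem_nhds _ one_pos
  set Pc := P.map (Int.castRingHom ℂ) with hPc
  set Prc := P.reverse.map (Int.castRingHom ℂ) with hPrc
  set Rc := R.map (Int.castRingHom ℂ) with hRc
  -- complex form of the integer identity
  have hidC : ∀ w : ℂ, (ε : ℂ) * Pc.eval w =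
      Prc.eval w * (1 + (a : ℂ) * w ^ k) + w ^ (k + 1) * Rc.eval w := by
    intro w
    have h := congrArg (fun Q : ℤ[X] => (Q.map (Int.castRingHom ℂ)).eval w) hid
    simpa [Polynomial.map_mul, Polynomial.map_add, Polynomial.map_pow, eval_mul, eval_add,
      eval_pow] using h
  -- a disc `ball 0 r` on which `P*` does not vanish
  have hPrc0 : Prc.eval 0 = 1 := by
    rw [← coeff_zero_eq_eval_zero, hPrc, coeff_map, coeff_zero_reverse, hmonic.leadingCoeff]; simp
  obtain ⟨r, hr0, hr1, hPr⟩ : ∃ r : ℝ, 0 < r ∧ r ≤ 1 ∧ ∀ w ∈ ball (0 : ℂ) r, Prc.eval w ≠ 0 := by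
    have hc : ContinuousAt (fun w => Prc.eval w) 0 := (Polynomial.continuous Prc).continuousAt
    have hne : ∀ᶠ w in 𝓝 (0 : ℂ), Prc.eval w ≠ 0 := by
      apply hc.eventually_ne; rw [hPrc0]; exact one_ne_zero
    obtain ⟨r, hr0, hr⟩ := Metric.eventually_nhds_iff_ball.mp hne
    exact ⟨min r 1, lt_min hr0 one_pos, min_le_right _ _,
      fun w hw => hr w (ball_subset_ball (min_le_left _ _) hw)⟩
  have hsub : ball (0 : ℂ) r ⊆ ball 0 1 := ball_subset_ball hr1
  have hballr : ball (0 : ℂ) r ∈ 𝓝 (0 : ℂ) := ball_mem_nhds _ hr0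
  -- the error term `E = R g / P*` and the pointwise identity `f = (1 + a w^k) g + w^{k+1} E`
  set E : ℂ → ℂ := fun w => Rc.eval w * g w / Prc.eval w with hE
  have hEc : ContinuousOn E (ball 0 r) := by
    apply ContinuousOn.div
    · exact (Polynomial.continuous Rc).continuousOn.mul (hgd.continuousOn.mono hsub)
    · exact (Polynomial.continuous Prc).continuousOn
    · exact hPr
  have hpt : ∀ w ∈ ball (0 : ℂ) r, f w = (1 + (a : ℂ) * w ^ k) * g w + w ^ (k + 1) * E w := by
    intro w hw
    have h1 := hfg w (hsub hw)
    have h2 := hidC w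
    have h3 := hPr w hw
    simp only [hE]
    field_simp
    linear_combination h1 + g w * h2
  -- roots of unity
  set ω : ℂ := Complex.exp (2 * Real.pi * Complex.I / k) with hωdef
  have hω : IsPrimitiveRoot ω k := Complex.isPrimitiveRoot_exp k (by omega)
  have hω1 : ‖ω‖ = 1 := hω.norm'_eq_one (by omega)
  have hωk : ω ^ k = 1 := hω.pow_eq_one
  -- the averaged functions and their flat decompositions
  set Φf : ℂ → ℂ := fun z => (k : ℂ)⁻¹ * ∑ j ∈ Finset.range k, f (ω ^ j * z) with hΦf_def
  set Φg : ℂ → ℂ := fun z => (k : ℂ)⁻¹ * ∑ j ∈ Finset.range k, g (ω ^ j * z) with hΦg_def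
  have hΦfd : DifferentiableOn ℂ Φf (ball 0 1) := differentiableOn_rotAvg k hω1 hfd
  have hΦgd : DifferentiableOn ℂ Φg (ball 0 1) := differentiableOn_rotAvg k hω1 hgd
  obtain ⟨ψf, hψfd, hψf⟩ := exists_flat_of_rotation_invariant hω hk hΦfd
    (fun z _ => rotAvg_rot k hωk f z)
  obtain ⟨ψg, hψgd, hψg⟩ := exists_flat_of_rotation_invariant hω hk hΦgd
    (fun z _ => rotAvg_rot k hωk g z)
  set c : ℂ := g 0 with hc
  have hΦf0 : Φf 0 = c := by rw [hΦf_def]; simp only; rw [rotAvg_zero hk, hf0]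
  have hΦg0 : Φg 0 = c := by rw [hΦg_def]; simp only; exact rotAvg_zero hk ω g
  -- Schwarz–Pick bounds
  have hbf : ‖ψf 0‖ ≤ 1 - ‖c‖ ^ 2 :=
    norm_coeff_le_one_sub_norm_sq hk hψfd (fun z hz => norm_rotAvg_le_one hk hω1 hfb hz)
      (fun z hz => by rw [← hΦf0]; exact hψf z hz)
  have hbg : ‖ψg 0‖ ≤ 1 - ‖c‖ ^ 2 :=
    norm_coeff_le_one_sub_norm_sq hk hψgd (fun z hz => norm_rotAvg_le_one hk hω1 hgb hz)
      (fun z hz => by rw [← hΦg0]; exact hψg z hz)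
  -- the coefficient relation `ψf 0 = ψg 0 + a c`
  set H : ℂ → ℂ := fun z => (k : ℂ)⁻¹ * ∑ j ∈ Finset.range k, ω ^ (j * (k + 1)) * E (ω ^ j * z)
    with hH
  have hHc : ContinuousOn H (ball 0 r) := by
    show ContinuousOn (fun z => (k : ℂ)⁻¹ *
      ∑ j ∈ Finset.range k, ω ^ (j * (k + 1)) * E (ω ^ j * z)) (ball 0 r)
    apply ContinuousOn.mul continuousOn_const
    apply continuousOn_finsetSum
    intro j _
    apply ContinuousOn.mul continuousOn_const
    exact hEc.comp (continuousOn_const.mul continuousOn_id) fun z hz => pow_mul_mem_ball hω1 j hz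
  have havg : ∀ z ∈ ball (0 : ℂ) r,
      Φf z = (1 + (a : ℂ) * z ^ k) * Φg z + z ^ (k + 1) * H z := by
    intro z hz
    have hsum : ∑ j ∈ Finset.range k, f (ω ^ j * z) = ∑ j ∈ Finset.range k,
        ((1 + (a : ℂ) * z ^ k) * g (ω ^ j * z) + z ^ (k + 1) * (ω ^ (j * (k + 1)) * E (ω ^ j * z))) := by
      apply Finset.sum_congr rfl
      intro j _
      rw [hpt _ (pow_mul_mem_ball hω1 j hz)]
      have hωjk : (ω ^ j) ^ k = 1 := by rw [← pow_mul, mul_comm, pow_mul, hωk, one_pow]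
      have e1 : (ω ^ j * z) ^ k = z ^ k := by rw [mul_pow, hωjk, one_mul]
      have e2 : (ω ^ j * z) ^ (k + 1) = ω ^ (j * (k + 1)) * z ^ (k + 1) := by
        rw [mul_pow, ← pow_mul]
      rw [e1, e2]
      ring
    show (k : ℂ)⁻¹ * ∑ j ∈ Finset.range k, f (ω ^ j * z) =
      (1 + (a : ℂ) * z ^ k) * ((k : ℂ)⁻¹ * ∑ j ∈ Finset.range k, g (ω ^ j * z)) +
        z ^ (k + 1) * ((k : ℂ)⁻¹ * ∑ j ∈ Finset.range k, ω ^ (j * (k + 1)) * E (ω ^ j * z))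
    rw [hsum, Finset.sum_add_distrib, ← Finset.mul_sum, ← Finset.mul_sum]
    ring
  have hrel : ψf 0 = ψg 0 + (a : ℂ) * c := by
    set G : ℂ → ℂ := fun z => ψf z - ψg z - (a : ℂ) * c - ((a : ℂ) * z ^ k * ψg z + z * H z)
      with hG
    have hGc : ContinuousAt G 0 := by
      have h1 : ContinuousAt ψf 0 := (hψfd.differentiableAt hball).continuousAt
      have h2 : ContinuousAt ψg 0 := (hψgd.differentiableAt hball).continuousAt
      have h3 : ContinuousAt H 0 := hHc.continuousAt hballr
      simp only [hG]
      fun_prop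
    have hGoff : G =ᶠ[𝓝[≠] (0 : ℂ)] fun _ => 0 := by
      have hmem : {(0 : ℂ)}ᶜ ∩ ball (0 : ℂ) r ∈ 𝓝[≠] (0 : ℂ) := inter_mem_nhdsWithin _ hballr
      filter_upwards [hmem] with z hz
      obtain ⟨hz0, hzr⟩ := hz
      have hz0' : z ≠ 0 := hz0
      have h := havg z hzr
      rw [hψf z (hsub hzr), hψg z (hsub hzr), hΦf0, hΦg0] at h
      have hzk : z ^ k ≠ 0 := pow_ne_zero k hz0'
      have h' : z ^ k * (ψf z - ψg z - (a : ℂ) * c - ((a : ℂ) * z ^ k * ψg z + z * H z)) = 0 := by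
        linear_combination h
      exact (mul_eq_zero.mp h').resolve_left hzk
    have hG0 : G 0 = 0 := by
      have h1 : Tendsto G (𝓝[≠] (0 : ℂ)) (𝓝 (G 0)) := hGc.tendsto.mono_left nhdsWithin_le_nhds
      have h2 : Tendsto G (𝓝[≠] (0 : ℂ)) (𝓝 0) := tendsto_const_nhds.congr' hGoff.symm
      exact tendsto_nhds_unique h1 h2
    simp only [hG, zero_pow (by omega : k ≠ 0), mul_zero, zero_mul, add_zero, sub_zero] at hG0
    linear_combination hG0
  -- conclusion
  have hac : ‖(a : ℂ) * c‖ ≤ 2 * (1 - ‖c‖ ^ 2) := by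
    have : (a : ℂ) * c = ψf 0 - ψg 0 := by rw [hrel]; ring
    rw [this]
    calc ‖ψf 0 - ψg 0‖ ≤ ‖ψf 0‖ + ‖ψg 0‖ := norm_sub_le _ _
      _ ≤ (1 - ‖c‖ ^ 2) + (1 - ‖c‖ ^ 2) := add_le_add hbf hbg
      _ = 2 * (1 - ‖c‖ ^ 2) := by ring
  rw [norm_mul, Complex.norm_intCast, hg0] at hac
  exact_mod_cast hac


/-! ### Elementary lower bounds `M(P) ≥ |lc P|`, `M(P) ≥ |P(0)|` -/

/-- `|lc P| ≤ M(P)`. -/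
theorem abs_leadingCoeff_le_intMahlerMeasure (P : ℤ[X]) :
    (|P.leadingCoeff| : ℝ) ≤ intMahlerMeasure P := by
  unfold intMahlerMeasure
  have h := leadingCoeff_le_mahlerMeasure (P.map (Int.castRingHom ℂ))
  rw [leadingCoeff_map_of_injective (RingHom.injective_int _), eq_intCast, Complex.norm_intCast] at h
  exact h

/-- For monic `P`: `|P(0)| ≤ M(P)` (the product of all the roots is `± P(0)`). -/
theorem abs_coeff_zero_le_intMahlerMeasure {P : ℤ[X]} (hmonic : P.Monic) :
    (|P.coeff 0| : ℝ) ≤ intMahlerMeasure P := by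
  classical
  set Pc := P.map (Int.castRingHom ℂ) with hPc
  have hPcm : Pc.Monic := hmonic.map _
  set S := Pc.roots with hSdef
  have hcard : Multiset.card S = Pc.natDegree := IsAlgClosed.card_roots_eq_natDegree
  have hprod : (S.map fun α => X - C α).prod = Pc :=
    prod_multiset_X_sub_C_of_monic_of_roots_card_eq hPcm hcard
  have h0 : ‖Pc.eval 0‖ = (S.map fun α => ‖α‖).prod := by
    rw [← hprod, eval_multiset_prod_X_sub_C, norm_multiset_prod_eq]
    congr 1; apply Multiset.map_congr rfl; intro α _; simp
  have h1 : (S.map fun α => ‖α‖).prod ≤ (S.map fun α => max 1 ‖α‖).prod := by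
    have := norm_multiset_prod_le (s := S) (φ := fun α => (‖α‖ : ℂ)) (χ := fun α => ((max 1 ‖α‖ : ℝ) : ℂ))
      (fun α _ => by
        rw [Complex.norm_real, Complex.norm_real, Real.norm_of_nonneg (norm_nonneg _),
          Real.norm_of_nonneg (le_trans zero_le_one (le_max_left _ _))]
        exact le_max_right _ _)
    rw [norm_multiset_prod_eq, norm_multiset_prod_eq] at this
    have e1 : (S.map fun α => ‖((‖α‖ : ℝ) : ℂ)‖) = S.map fun α => ‖α‖ := by
      apply Multiset.map_congr rfl; intro α _
      rw [Complex.norm_real, Real.norm_of_nonneg (norm_nonneg _)]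
    have e2 : (S.map fun α => ‖((max 1 ‖α‖ : ℝ) : ℂ)‖) = S.map fun α => max 1 ‖α‖ := by
      apply Multiset.map_congr rfl; intro α _
      rw [Complex.norm_real, Real.norm_of_nonneg (le_trans zero_le_one (le_max_left _ _))]
    rwa [e1, e2] at this
  have hev : ‖Pc.eval 0‖ = (|P.coeff 0| : ℝ) := by
    rw [← coeff_zero_eq_eval_zero, hPc, coeff_map, eq_intCast, Complex.norm_intCast]
  unfold intMahlerMeasure
  rw [← hPc, mahlerMeasure_eq_leadingCoeff_mul_prod_roots, hPcm.leadingCoeff, norm_one, one_mul, ← hSdef,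
    ← hev, h0]
  exact h1

/-! ### The theorem -/

/-- The algebra of the conclusion: from `x ≤ 2 (1 - x²)` with `x = 1/M > 0` one gets
`M ≥ (1 + √17)/4`. -/
theorem bound_of_quadratic {M : ℝ} (hM : 0 < M) (h : M⁻¹ ≤ 2 * (1 - M⁻¹ ^ 2)) :
    (1 + Real.sqrt 17) / 4 ≤ M := by
  set x := M⁻¹ with hx
  have hx0 : 0 < x := inv_pos.mpr hM
  set s := Real.sqrt 17 with hs
  have hs2 : s ^ 2 = 17 := Real.sq_sqrt (by norm_num)
  have hs0 : 0 ≤ s := Real.sqrt_nonneg 17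
  set ρ := (s - 1) / 4 with hρ
  have hρeq : 2 * ρ ^ 2 + ρ - 2 = 0 := by rw [hρ]; nlinarith [hs2]
  have hρ0 : 0 < ρ := by
    rw [hρ]
    have : 1 < s := by nlinarith [hs2, hs0]
    linarith
  have hxρ : x ≤ ρ := by
    by_contra hlt
    push Not at hlt
    have h1 : 0 < (x - ρ) * (2 * (x + ρ) + 1) := mul_pos (by linarith) (by linarith)
    have h2 : (x - ρ) * (2 * (x + ρ) + 1) = (2 * x ^ 2 + x - 2) - (2 * ρ ^ 2 + ρ - 2) := by ring
    rw [h2, hρeq, sub_zero] at h1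
    linarith
  have hρinv : ρ⁻¹ = (1 + s) / 4 := by
    have : ρ * ((1 + s) / 4) = 1 := by rw [hρ]; nlinarith [hs2]
    exact (eq_inv_of_mul_eq_one_right this).symm
  calc (1 + s) / 4 = ρ⁻¹ := hρinv.symm
    _ ≤ x⁻¹ := inv_anti₀ hx0 hxρ
    _ = M := by rw [hx, inv_inv]

/-- **Nonreciprocal integer polynomials have Mahler measure `≥ (1+√17)/4 = 1.2807…`**
([McKee–Smyth, *Around the Unit Circle*, (12.10)]; the first step of Smyth's 1971 proof that in fact
`M ≥ θ₀ = 1.3247…`).  Hypotheses: `P(0) ≠ 0` and `P` is neither reciprocal nor antireciprocal. -/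
theorem intMahlerMeasure_ge_of_nonreciprocal {P : ℤ[X]} (h0 : P.coeff 0 ≠ 0) (h1 : P.reverse ≠ P)
    (h2 : P.reverse ≠ -P) : (1 + Real.sqrt 17) / 4 ≤ intMahlerMeasure P := by
  have hP0 : P ≠ 0 := fun h => h0 (by simp [h])
  have hs2 : Real.sqrt 17 ^ 2 = 17 := Real.sq_sqrt (by norm_num)
  have hs0 : 0 ≤ Real.sqrt 17 := Real.sqrt_nonneg 17
  have hbound2 : (1 + Real.sqrt 17) / 4 ≤ 2 := by nlinarith [hs2, hs0]
  -- leading coefficient `± 1`, else `M ≥ 2`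
  by_cases hlc : 2 ≤ |P.leadingCoeff|
  · have h := abs_leadingCoeff_le_intMahlerMeasure P
    have : (2 : ℝ) ≤ |(P.leadingCoeff : ℝ)| := by exact_mod_cast hlc
    linarith
  have hlc1 : |P.leadingCoeff| = 1 := by
    have hne : P.leadingCoeff ≠ 0 := leadingCoeff_ne_zero.mpr hP0
    have := Int.one_le_abs hne
    omega
  -- reduce to the monic case via `P ↦ -P`
  obtain ⟨Q, hQm, hQM, hQ0, hQ1, hQ2⟩ : ∃ Q : ℤ[X], Q.Monic ∧ intMahlerMeasure Q = intMahlerMeasure P ∧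
      Q.coeff 0 ≠ 0 ∧ Q.reverse ≠ Q ∧ Q.reverse ≠ -Q := by
    rcases (abs_eq (zero_le_one' ℤ)).mp hlc1 with h | h
    · exact ⟨P, h, rfl, h0, h1, h2⟩
    · refine ⟨-P, ?_, intMahlerMeasure_neg P, by simpa using h0, ?_, ?_⟩
      · rw [Monic, leadingCoeff_neg, h, neg_neg]
      · rw [reverse_neg]; intro h'; exact h1 (neg_injective h')
      · rw [reverse_neg, neg_neg]; intro h'; exact h2 (by rw [← neg_neg P.reverse, h'])
  rw [← hQM]
  -- constant coefficient `± 1`, else `M ≥ 2`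
  by_cases hc : 2 ≤ |Q.coeff 0|
  · have h := abs_coeff_zero_le_intMahlerMeasure hQm
    have : (2 : ℝ) ≤ |(Q.coeff 0 : ℝ)| := by exact_mod_cast hc
    linarith
  have hc1 : |Q.coeff 0| = 1 := by
    have := Int.one_le_abs hQ0
    omega
  set ε := Q.coeff 0 with hεdef
  have hε1 : ε * ε = 1 := by
    rcases (abs_eq (zero_le_one' ℤ)).mp hc1 with h | h <;> simp [h]
  have hne : Q.reverse ≠ C ε * Q := by
    rcases (abs_eq (zero_le_one' ℤ)).mp hc1 with h | h
    · rw [h, C_1, one_mul]; exact hQ1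
    · rw [h, C_neg, C_1, neg_one_mul]; exact hQ2
  obtain ⟨k, a, R, hk, ha, hid⟩ := exists_first_nonpalindromic_coeff hQm rfl hε1 hne
  have key := abs_mul_inv_measure_le hQm rfl hε1 hk hid
  have hM1 : 1 ≤ intMahlerMeasure Q := by
    have h := abs_leadingCoeff_le_intMahlerMeasure Q
    rw [hQm.leadingCoeff] at h; simpa using h
  have hMpos : 0 < intMahlerMeasure Q := lt_of_lt_of_le one_pos hM1
  have ha1 : (1 : ℝ) ≤ |(a : ℝ)| := by exact_mod_cast Int.one_le_abs ha
  have hx0 : 0 < (intMahlerMeasure Q)⁻¹ := inv_pos.mpr hMpos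
  have key' : (intMahlerMeasure Q)⁻¹ ≤ 2 * (1 - (intMahlerMeasure Q)⁻¹ ^ 2) := by
    calc (intMahlerMeasure Q)⁻¹ = 1 * (intMahlerMeasure Q)⁻¹ := (one_mul _).symm
      _ ≤ |(a : ℝ)| * (intMahlerMeasure Q)⁻¹ := by gcongr
      _ ≤ _ := key
  exact bound_of_quadratic hMpos key'

/-- Numerical form: a nonreciprocal integer polynomial with `P(0) ≠ 0` has `M(P) > 1.28`. -/
theorem intMahlerMeasure_gt_of_nonreciprocal {P : ℤ[X]} (h0 : P.coeff 0 ≠ 0) (h1 : P.reverse ≠ P)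
    (h2 : P.reverse ≠ -P) : (128 : ℝ) / 100 < intMahlerMeasure P := by
  have h := intMahlerMeasure_ge_of_nonreciprocal h0 h1 h2
  have hs2 : Real.sqrt 17 ^ 2 = 17 := Real.sq_sqrt (by norm_num)
  have hs0 : 0 ≤ Real.sqrt 17 := Real.sqrt_nonneg 17
  have : (128 : ℝ) / 100 < (1 + Real.sqrt 17) / 4 := by nlinarith [hs2, hs0]
  linarith

end Summit.Ventures.DiscreteObjects.Mahler
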